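import Summits.CriticalPhenomena.SAWScalingLimit.Theses.SAWSpinMonotone
import Summits.CriticalPhenomena.SAWScalingLimit.Theorems.SAWSpinMonotoneArrivalFlatteningReduction

/-!
# Line `spin-chord` for the crux `SAWSpinMonotone.ArrivalFlattening` (stmt-CriticalPhenomena-16770) — skeleton v4 (lead c1)

Lead `prover-line-stmt-CriticalPhenomena-16770-c1-0` (continuation seat, 2026-08-17), after lead `-0`'s v3 (sha 81ba14c9…, stubs
S1 `stub_threeSpinChord`, S2 `stub_spinMonotonePair`, S4 `stub_throughMassDecay`; S3 `stub_exitSpinBound` landed p166590). Tree path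
`Summits/CriticalPhenomena/SAWScalingLimit/Cruxes/ArrivalFlattening/Lines/spin_chord.lean`; card `Lines/spin-chord.md`; evidence
`S4-REFUTED.md` (this seat), `S1-EVIDENCE.md`, `S4-EVIDENCE.md` (lead -0), `Disproof.lean` (cdisprove, cycle 1 final).

Crux (FIXED, by name): `ArrivalFlattening` — for every `ε > 0` there is a depth `R` such that for every simply connected `Λ`, boundary
mid-edge `a`, `R`-deep `v ∈ Λ` and pairwise distinct neighbours `w₀ w₁ w₂`: `‖A_v(11/8)‖ ≤ ε ‖A_v(5/8)‖`, where
`A_v(s) = arrivalTransform Λ a v w₀ w₁ w₂ s = Σⱼ F_{Λ.erase v}(a, {v,wⱼ}; x_c, s)` (first-arrival spin transform, Defs module p165751).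

## What changed in v4 (cycle c1): the exit chain is OUT of the composition — S4 is false as typed

v3 derived the milestone (D) `MonopoleDecay` (`‖A(5/8)‖ = o(A(0))`) through the exit chain
`‖A(5/8)‖ ≤_{S2} ‖A(3/8)‖ ≤_{S3} ThroughMass ≤_{S4} η·A(0)`. S4 `ThroughMassDecay` quantifies, like the crux, over ALL simply connected far
fields `Λ ⊇ B_R(v)` and all roots `a ∈ ∂Λ`; but `ThroughMass` (the phase-free `x_c`-mass of walks `a → v → ∂Λ`) is NOT bounded in terms of
the arrival mass `A(0)` at fixed depth: take `Λ_L = B_L(v) ∖ needle`, the needle a radial line of removed vertices from `∂B_L` to distance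
`R + 1` of `v`, root `a` = the mid-edge at the needle's TIP, and let `L → ∞` with `R` fixed. The arrivals `a → v` are local (`A(0)` converges
as `L → ∞`), while every arrival prefix `γ` is followed by escapes `v → ∂B_L` that, seen from scales `≫ R`, are ONE self-avoiding arm from the
tip of a slit to distance `L`: `x_c`-mass `≍ L · L^{-x_tip - x_b}` with `x_b = 5/8` (boundary one-arm) and `x_tip = (π/2π)·x_b = 5/16` (wedge
rule at a slit tip, Cardy 1984 / Duplantier–Saleur 1986) — exponent `1 - 15/16 = +1/16 > 0`. So `ThroughMass/A(0) ≍ c(R)·(L/R)^{1/16} → ∞`: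
for NO `η` is there a depth beyond which `ThroughMass ≤ η A(0)` holds uniformly — ¬S4 (in the same Coulomb-gas calculus that gave S4 its
only support, the ball rate `R^{-9/48}`; the strategist's census N4 had the same tip-escape growth for the γ-wise sup but missed that the
DOMAIN may carry the needle). Exact transfer-matrix numerics (σ = 0, `exp/s4test.py`, kit j027848): at fixed depth 2.0 the ratio
`ThroughMass/A(0)` of the needle family INCREASES with `L` (1.034, 1.054, 1.090, 1.087, 1.106, 1.121 at L = 2.1 … 4.5) and its outer-arc
part stays flat (1.00 ± 0.02), whereas behind a FLAT boundary at the same sizes the outer-arc part decays (0.996 → 0.803, depth 2.52) as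
boundary-to-boundary escapes must (`x_b + x_b = 5/4 > 1`). The landed S3 (`‖A(3/8)‖ ≤ ThroughMass`, p166590) stays true but is not
tight there: the exit-spin IDENTITY behind it bounds `‖A(3/8)‖` by a PHASED boundary sum, and the needle's arc and needle-side escapes
cancel in that sum (the DCS boundary phases span 202.5° > 180° around a slit) — dropping the phases (ThroughMass) loses exactly this.
Consequence: no phase-free positive-mass quantity on `∂Λ` controls the `3/8`-character uniformly in the far field; the honest open node
of the line is (D) itself. v4 therefore registers TWO stubs — S1 `stub_threeSpinChord : ThreeSpinChord` (unchanged) and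
S5 `stub_monopoleDecay : MonopoleDecay` — and concludes the crux by the landed two-hypothesis glue
`arrivalFlattening_of_chord_of_monopoleDecay` (Reduction module p168461). S2 (`SpinMonotonePair`, ⇐ sister crux stmt-16769) and the
phased exit route survive as a documented ALTERNATIVE into S5 (§5: `ExitCharacterDecay`, glue `monopoleDecay_of_pair_of_exitCharacter`),
not as registered stubs.

## State of the stubs (cycle c1)
* S1 `stub_threeSpinChord` — OPEN, conjecture-grade shape inequality (0 violations in > 63 000 exact laws, `inf K* = 1.28` at depth ≥ 2,
  envelope rising with depth; insensitive to the receding-boundary family: all three characters are arrival-local).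
* S5 `stub_monopoleDecay` — OPEN, conjecture-grade and CRUX-SIZED: `‖A_v(5/8)‖ = o(A_v(0))` uniformly = delocalisation of the first-arrival
  winding law over the winding classes (predicted rate `R^{-25/48}`; exact numerics `sup m = 0.77 → 0.50` from depth 1.5 to 4.4, monotone);
  a winding theorem for the critical SAW conditioned on its endpoint — no such theorem exists in print (presearch in NOTES.md). This is the
  statement the lead hands back for promotion (`promote-stub`).
* Landed and still valid: Defs p165751, S3 p166590, Reduction p168461 (incl. `monopoleDecay_of`, now moot because its hypothesis S4 is false).

Obstructions honoured (Disproof.lean, cycle 1 final): depth load-bearing (all statements inside `AtDepth`, order `∃R ∀Λ`), portwise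
strengthening false (S5 is about the port SUM's character, not a port), SC numerically load-bearing (pincer ×(2+√3)) — S1/S5 quantify over
simply connected `Λ` only; Galois alias `A(5/8)=0 ⟺ A(11/8)=0` consistent with S1. Dead inside this line: the phase-free exit chain (S4).
-/

noncomputable section

namespace Summit.CriticalPhenomena.SAWScalingLimit.Cruxes.ArrivalFlattening.SpinChord

open Literature.Probability.LatticeModels
open Literature.Probability.RandomPlanarGeometry Literature.Probability.RandomPlanarGeometry.SAW
open Summit.CriticalPhenomena.SAWScalingLimit.Theses.SAWSpinMonotone (ArrivalFlattening SpinMonotone)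

/-! ## 1. The crux in the line's vocabulary (landed as `arrivalFlattening_iff_atDepth`, `Iff.rfl`) -/

example : ArrivalFlattening ↔ ∀ ε : ℝ, 0 < ε → ∃ R : ℝ, AtDepth R (fun Λ a v w₀ w₁ w₂ =>
    ‖arrivalTransform Λ a v w₀ w₁ w₂ (11 / 8)‖ ≤ ε * ‖arrivalTransform Λ a v w₀ w₁ w₂ (5 / 8)‖) :=
  arrivalFlattening_iff_atDepth

/-! ## 2. Registered stubs (`sorry` only here) -/

/-- **S1 `stub_threeSpinChord`** — `ThreeSpinChord`: `∃ K > 0, ∃ R₁, AtDepth R₁ (‖A(11/8)‖·‖A(0)‖^K ≤ ‖A(5/8)‖^{1+K})`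
(OPEN, conjecture-grade; a finite shape inequality per configuration, exact-enumerable; evidence `S1-EVIDENCE.md`, Disproof §5). -/
theorem stub_threeSpinChord : ThreeSpinChord := by
  sorry

/-- **S5 `stub_monopoleDecay`** — `MonopoleDecay`: `∀ η > 0, ∃ R, AtDepth R (‖A(5/8)‖ ≤ η ‖A(0)‖)` (OPEN, conjecture-grade,
crux-sized: delocalisation of the first-arrival winding law; replaces the refuted exit chain S2–S4 of v3). -/
theorem stub_monopoleDecay : MonopoleDecay := by
  sorry

/-! ### Name-keyed aliases of the two statements — the hypotheses of `ArrivalFlattening_of` -/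
namespace __Registered

/-- Alias of `ThreeSpinChord` keyed by the registered stub name. -/
abbrev stub_threeSpinChord : Prop := ThreeSpinChord
/-- Alias of `MonopoleDecay` keyed by the registered stub name. -/
abbrev stub_monopoleDecay : Prop := MonopoleDecay

end __Registered

/-! ## 3. The skeleton theorem: the two open stubs imply the crux, BY NAME (glue landed, p168461) -/

/-- **`ArrivalFlattening` from the line `spin-chord` (v4)**: hypotheses = the two OPEN stubs under their registered names (S1 chord,
S5 monopole decay); conclusion = the route decl, by name; proof = the landed composition `arrivalFlattening_of_chord_of_monopoleDecay`
(`η = ε^{1/K}`, `chord_step`, degenerate masses by `norm_arrivalTransform_le`). No `sorry` of its own. -/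
theorem ArrivalFlattening_of (h1 : __Registered.stub_threeSpinChord) (h5 : __Registered.stub_monopoleDecay) :
    Summit.CriticalPhenomena.SAWScalingLimit.Theses.SAWSpinMonotone.ArrivalFlattening :=
  arrivalFlattening_of_chord_of_monopoleDecay h1 h5

/-- Wiring check (an `example`, so that `ArrivalFlattening_of` stays the first theorem concluding the crux from the stubs). -/
example : Summit.CriticalPhenomena.SAWScalingLimit.Theses.SAWSpinMonotone.ArrivalFlattening :=
  ArrivalFlattening_of stub_threeSpinChord stub_monopoleDecay

/-! ## 4. What the crux gives back (sorry-free; orientation for refuters of S1/S5) -/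

/-- The crux alone gives `‖A(11/8)‖ ≤ ε‖A(0)‖` (the trivial direction through mass domination) — neither S1 nor S5. [folklore] -/
theorem eleven_le_eps_mass (h : ArrivalFlattening) :
    ∀ ε : ℝ, 0 < ε → ∃ R : ℝ, AtDepth R (fun Λ a v w₀ w₁ w₂ =>
      ‖arrivalTransform Λ a v w₀ w₁ w₂ (11 / 8)‖ ≤ ε * ‖arrivalTransform Λ a v w₀ w₁ w₂ 0‖) := by
  intro ε hε
  obtain ⟨R, hR⟩ := arrivalFlattening_iff_atDepth.mp h ε hε
  refine ⟨R, ?_⟩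
  intro Λ hΛ a ha v hv hball w₀ w₁ w₂ h₀ h₁ h₂ n₁ n₂ n₃
  exact (hR Λ hΛ a ha v hv hball w₀ w₁ w₂ h₀ h₁ h₂ n₁ n₂ n₃).trans
    (mul_le_mul_of_nonneg_left (norm_arrivalTransform_le Λ a v w₀ w₁ w₂ (5 / 8)) hε.le)

/-- (D) with `η = 1` is free at every depth (mass domination): the content of S5 is `η → 0`. [folklore] -/
theorem monopole_le_mass (R : ℝ) : AtDepth R (fun Λ a v w₀ w₁ w₂ =>
    ‖arrivalTransform Λ a v w₀ w₁ w₂ (5 / 8)‖ ≤ 1 * ‖arrivalTransform Λ a v w₀ w₁ w₂ 0‖) := by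
  intro Λ hΛ a ha v hv hball w₀ w₁ w₂ h₀ h₁ h₂ n₁ n₂ n₃
  rw [one_mul]; exact norm_arrivalTransform_le Λ a v w₀ w₁ w₂ (5 / 8)

/-! ## 5. The surviving alternative into S5: the PHASED exit route (documentation; not registered)

The exit-spin identity behind the landed S3 writes `(h/2)·‖A_v(3/8)‖` EXACTLY as the modulus of a phased boundary sum
`Σ_{z ∈ ∂Λ} (mid_z − c_{u_z})·T(z)` of the through-`v` observable. Its phase-free majorant `ThroughMass` is unbounded in the far field
(above), but the character itself is arrival-local; so the exit route survives only in the form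
`‖A(5/8)‖ ≤_{FM pair} ‖A(3/8)‖ = o(A(0))` — (P) `SpinMonotonePair` (⇐ sister crux `SpinMonotone`, stmt-16769, discharge landed) plus
(E′) `ExitCharacterDecay` below (predicted rate `R^{-9/48}`, slower than S5's `R^{-25/48}`; same epistemic grade as S5, with the
identity as its only extra handle). Recorded so that a planner promoting S5 sees both doors; nothing here is registered or asserted. -/

/-- **(E′) Exit-character decay**: for every `η > 0` there is a depth `R` such that at every admissible `R`-deep configuration
`‖A_v(3/8)‖ ≤ η ‖A_v(0)‖` — the `45°`-character of the first-arrival winding law is `o(mass)`, uniformly in the simply connected far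
field. A statement (documentation of the alternative route into S5), not asserted. -/
def ExitCharacterDecay : Prop :=
  ∀ η : ℝ, 0 < η → ∃ R : ℝ, AtDepth R (fun Λ a v w₀ w₁ w₂ =>
    ‖arrivalTransform Λ a v w₀ w₁ w₂ (3 / 8)‖ ≤ η * ‖arrivalTransform Λ a v w₀ w₁ w₂ 0‖)

/-- The phased exit route: (P) + (E′) give S5, at depth `max R₂ R(η)`. [folklore] -/
theorem monopoleDecay_of_pair_of_exitCharacter (hP : SpinMonotonePair) (hE : ExitCharacterDecay) : MonopoleDecay := by
  intro η hη
  obtain ⟨R₂, hpair⟩ := hP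
  obtain ⟨R₃, hexit⟩ := hE η hη
  refine ⟨max R₂ R₃, ?_⟩
  intro Λ hΛ a ha v hv hball w₀ w₁ w₂ h₀ h₁ h₂ n₁ n₂ n₃
  exact (atDepth_mono (le_max_left R₂ R₃) hpair Λ hΛ a ha v hv hball w₀ w₁ w₂ h₀ h₁ h₂ n₁ n₂ n₃).trans
    (atDepth_mono (le_max_right R₂ R₃) hexit Λ hΛ a ha v hv hball w₀ w₁ w₂ h₀ h₁ h₂ n₁ n₂ n₃)

/-- Hence the crux from S1 + the sister crux + (E′) (conditional; orientation only — an `example`, so that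
`ArrivalFlattening_of` is the ONLY declaration of this file concluding the crux). -/
example (hC : ThreeSpinChord) (hFM : SpinMonotone) (hE : ExitCharacterDecay) : ArrivalFlattening :=
  arrivalFlattening_of_chord_of_monopoleDecay hC
    (monopoleDecay_of_pair_of_exitCharacter (spinMonotonePair_of_spinMonotone hFM) hE)

end Summit.CriticalPhenomena.SAWScalingLimit.Cruxes.ArrivalFlattening.SpinChord

end
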